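/-
Copyright: the b2b-balaban T⁴-continuum CRUX team, row NE7b OWNER lineage `t4-ne7b-p1` (gen 131). Project licence.
-/
import Summits.QuantumFields.BalabanUV.T4Continuum.Spine.NE7b.SupTiltedSteinIdentity

/-!
# THE COVARIANCE OF A LINEAR OBSERVABLE UNDER THE TILTED LAW IS A FINITE-RANGE ROW AGAINST ONE-SITE COVARIANCES: dividing (345)'s tilted
# Stein identity by `Z = ∫e^{−V}dN(0,Γ) > 0` (nonnegative `C¹` remainders, one-site `C¹` observable `G` of polynomial growth at `z`),
#   `E_ν[ω_y] = −Σ_{x∈Y}Γ_{yx}E_ν[w′_x]`,   `E_ν[ω_yG_z] = Γ_{yz}E_ν[G′_z] − Σ_{x∈Y}Γ_{yx}E_ν[G_zw′_x]`,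
#   `Cov_ν(ω_y, G_z) = Γ_{yz}E_ν[G′_z] − Σ_{x∈Y}Γ_{yx}·Cov_ν(w′_x, G_z)`
# — so with `Γ` of finite range and (332c)'s decay of the ONE-SITE covariances `Cov_ν(w′_x, G_z)`, linear observables decorrelate at the same
# exponential rate (the successor's assembly) (row NE7b, node U5c; (345) BY NAME; [folklore])

Cell `pub-balaban`, sub-cell `t4`, spine estimate NE7b (`T4WeightBudget.RelWeightBound`; the cell's OWN estimate — NOT PRINTED in
[Bałaban 1983–89], NOT PROVED).  Crux-route work under `Spine/NE7b/` by the row OWNER (`t4-ne7b-p1` gen 131, file (346)) under FREEZE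
(0)'s crux-prover clause, on § [NE7bP1-G130-HANDOFF] NEXT (3)(b); NOTHING of Bałaban's is named as a Lean object, valued or asserted; no
`T4Continuum/Support` leaf typed; no `def`, no notation; zero `sorry`.  Imports (BY NAME): the OWNER's (345) `…SupTiltedSteinIdentity`
(`tilted_stein`, `tilted_stein_mean`, `integrable_of_poly_growth`); Mathlib's `integral_exp_pos`.

WHAT IS PROVED ([folklore]): §1 `lineZ_pos'` (`Z > 0` for nonnegative measurable remainders), `cov_algebra_sum` (the division bookkeeping);
§2 THE END **`tilted_mean_linear`** (`E_ν[ω_y] = −Σ_xΓ_{yx}E_ν[w′_x]`), **`tilted_cov_linear`**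
(`E_ν[ω_yG_z] − E_ν[ω_y]E_ν[G_z] = Γ_{yz}E_ν[G′_z] − Σ_{x∈Y}Γ_{yx}(E_ν[G_zw′_x] − E_ν[w′_x]E_ν[G_z])`); §3 toy.

HONEST (what this is NOT).  Algebra on (345); nonnegative class only; the decay assembly with (332c) and the finite range of `Γ` is the
successor's; scalar skeleton ((A3), NC-NE7b-α UNRULED); nothing of Bałaban's asserted.  BY-NAME EFFECT ON THE WALL: NONE.  NE7b NOT
PRINTED ∕ NOT PROVED; spine PROVED 0∕9; rung (B)+1 — the programme's measures remain FINITE-torus statements; NOT the mass gap, NOT Clay.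
HONEST DEPENDENCY: continuum YM on T⁴ ⇐ BetaPertH ∧ nine spine estimates (0∕9 proved); BetaPertH ⇐ (D1) ∧ (D4) ∧ CAP+tail; G-an2-4 gates
asym, D1 and NE2∕3∕4.
-/

set_option autoImplicit false

noncomputable section

namespace Summit.QuantumFields.BalabanUV.T4Continuum.NE7b.SupTiltedLinearCovariance

open MeasureTheory ProbabilityTheory Finset Real
open scoped BigOperators
open SupTiltedSteinIdentity (tilted_stein tilted_stein_mean integrable_of_poly_growth)

variable {ι : Type} [Fintype ι] [DecidableEq ι]

/-! ## §1. Bookkeeping -/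

/-- **`Z > 0`** for nonnegative measurable remainders (the integrand is bounded by `1`, hence integrable, and positive). [folklore] -/
theorem lineZ_pos' (Γ : Matrix ι ι ℝ) (Y : Finset ι) {w : ι → ℝ → ℝ} (hwm : ∀ x, Measurable (w x)) (hw0 : ∀ x t, 0 ≤ w x t)
    (ψ : ι → ℝ) :
    Integrable (fun ω : EuclideanSpace ℝ ι => exp (-(∑ x ∈ Y, w x (ω x + ψ x)))) (multivariateGaussian 0 Γ) ∧
      0 < ∫ ω : EuclideanSpace ℝ ι, exp (-(∑ x ∈ Y, w x (ω x + ψ x))) ∂(multivariateGaussian 0 Γ) := by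
  have hEm : Measurable fun ω : EuclideanSpace ℝ ι => exp (-(∑ x ∈ Y, w x (ω x + ψ x))) :=
    measurable_exp.comp (Finset.measurable_sum _ fun x _ =>
      (hwm x).comp ((by fun_prop : Measurable fun ω : EuclideanSpace ℝ ι => ω x).add_const _)).neg
  have hint : Integrable (fun ω : EuclideanSpace ℝ ι => exp (-(∑ x ∈ Y, w x (ω x + ψ x)))) (multivariateGaussian 0 Γ) := by
    refine integrable_of_poly_growth Γ hEm.aestronglyMeasurable (fun ω => (?_ : _ ≤ (1 : ℝ) * (1 + ‖ω‖) ^ 0))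
    rw [pow_zero, mul_one, Real.norm_eq_abs, abs_of_pos (exp_pos _)]
    exact exp_le_one_iff.2 (neg_nonpos.2 (sum_nonneg fun x _ => hw0 x _))
  exact ⟨hint, integral_exp_pos hint⟩

omit [Fintype ι] [DecidableEq ι] in
/-- **The division bookkeeping**: `Z ≠ 0` ⟹
`(γI_G′ − Σ_x g_xJ_x)∕Z − ((−Σ_x g_xI_x)∕Z)(I_G∕Z) = γ(I_G′∕Z) − Σ_x g_x(J_x∕Z − (I_x∕Z)(I_G∕Z))`. [folklore] -/
theorem cov_algebra_sum {κ : Type*} (s : Finset κ) (g I J : κ → ℝ) {Z IG IG' γ : ℝ} (hZ : Z ≠ 0) :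
    (γ * IG' - ∑ x ∈ s, g x * J x) / Z - (-(∑ x ∈ s, g x * I x)) / Z * (IG / Z) =
      γ * (IG' / Z) - ∑ x ∈ s, g x * (J x / Z - I x / Z * (IG / Z)) := by
  have e : ∀ x ∈ s, g x * (J x / Z - I x / Z * (IG / Z)) = g x * J x / Z - g x * I x * IG / Z ^ 2 := fun x _ => by ring
  rw [sum_congr rfl e, sum_sub_distrib, ← sum_div, ← sum_div, ← sum_mul]
  field_simp
  ring

/-! ## §2. THE END: tilted means and covariances of linear observables -/

section Main

variable {Γ : Matrix ι ι ℝ} (Y : Finset ι) {w w' : ι → ℝ → ℝ} {F F' : ℝ → ℝ} {κ₁ c : ℝ} {m : ℕ} (ψ : ι → ℝ) (y z : ι)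

/-- **THE TILTED MEAN OF `ω_y`**: `E_ν[ω_y] = −Σ_{x∈Y}Γ_{yx}E_ν[w′_x(u_x)]`. [folklore] -/
theorem tilted_mean_linear (hΓ : Γ.PosSemidef) (hwC : ∀ x, ContDiff ℝ 1 (w x)) (hw' : ∀ x t, HasDerivAt (w x) (w' x t) t)
    (hw'm : ∀ x, Measurable (w' x)) (hw0 : ∀ x t, 0 ≤ w x t) (hκ₁ : 0 ≤ κ₁) (hw'b : ∀ x t, |w' x t| ≤ κ₁ * |t|) :
    (∫ ω : EuclideanSpace ℝ ι, ω y * exp (-(∑ x ∈ Y, w x (ω x + ψ x))) ∂(multivariateGaussian 0 Γ)) /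
        (∫ ω : EuclideanSpace ℝ ι, exp (-(∑ x ∈ Y, w x (ω x + ψ x))) ∂(multivariateGaussian 0 Γ)) =
      -∑ x ∈ Y, Γ y x * ((∫ ω : EuclideanSpace ℝ ι, exp (-(∑ x' ∈ Y, w x' (ω x' + ψ x'))) * w' x (ω x + ψ x)
        ∂(multivariateGaussian 0 Γ)) / (∫ ω : EuclideanSpace ℝ ι, exp (-(∑ x ∈ Y, w x (ω x + ψ x))) ∂(multivariateGaussian 0 Γ))) := by
  rw [tilted_stein_mean Y ψ y hΓ hwC hw' hw'm hw0 hκ₁ hw'b, neg_div, sum_div]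
  congr 1
  exact sum_congr rfl fun x _ => mul_div_assoc _ _ _

/-- **THE TILTED COVARIANCE OF `ω_y` WITH A ONE-SITE OBSERVABLE** (hypotheses of (345) `tilted_stein`):
`E_ν[ω_yG_z] − E_ν[ω_y]E_ν[G_z] = Γ_{yz}E_ν[G′_z] − Σ_{x∈Y}Γ_{yx}(E_ν[G_zw′_x] − E_ν[w′_x]E_ν[G_z])`, i.e.
`Cov_ν(ω_y, G_z) = Γ_{yz}E_ν[G′_z] − Σ_{x∈Y}Γ_{yx}Cov_ν(w′_x, G_z)`. [folklore] -/
theorem tilted_cov_linear (hΓ : Γ.PosSemidef) (hwC : ∀ x, ContDiff ℝ 1 (w x)) (hw' : ∀ x t, HasDerivAt (w x) (w' x t) t)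
    (hw'm : ∀ x, Measurable (w' x)) (hw0 : ∀ x t, 0 ≤ w x t) (hκ₁ : 0 ≤ κ₁) (hw'b : ∀ x t, |w' x t| ≤ κ₁ * |t|)
    (hFC : ContDiff ℝ 1 F) (hF' : ∀ t, HasDerivAt F (F' t) t) (hF'm : Measurable F') (hc : 0 ≤ c)
    (hFg : ∀ t, |F t| ≤ c * (1 + |t|) ^ m) (hF'g : ∀ t, |F' t| ≤ c * (1 + |t|) ^ m) :
    (∫ ω : EuclideanSpace ℝ ι, ω y * (exp (-(∑ x ∈ Y, w x (ω x + ψ x))) * F (ω z + ψ z)) ∂(multivariateGaussian 0 Γ)) /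
          (∫ ω : EuclideanSpace ℝ ι, exp (-(∑ x ∈ Y, w x (ω x + ψ x))) ∂(multivariateGaussian 0 Γ)) -
        (∫ ω : EuclideanSpace ℝ ι, ω y * exp (-(∑ x ∈ Y, w x (ω x + ψ x))) ∂(multivariateGaussian 0 Γ)) /
            (∫ ω : EuclideanSpace ℝ ι, exp (-(∑ x ∈ Y, w x (ω x + ψ x))) ∂(multivariateGaussian 0 Γ)) *
          ((∫ ω : EuclideanSpace ℝ ι, exp (-(∑ x ∈ Y, w x (ω x + ψ x))) * F (ω z + ψ z) ∂(multivariateGaussian 0 Γ)) /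
            (∫ ω : EuclideanSpace ℝ ι, exp (-(∑ x ∈ Y, w x (ω x + ψ x))) ∂(multivariateGaussian 0 Γ))) =
      Γ y z * ((∫ ω : EuclideanSpace ℝ ι, exp (-(∑ x ∈ Y, w x (ω x + ψ x))) * F' (ω z + ψ z) ∂(multivariateGaussian 0 Γ)) /
          (∫ ω : EuclideanSpace ℝ ι, exp (-(∑ x ∈ Y, w x (ω x + ψ x))) ∂(multivariateGaussian 0 Γ))) -
        ∑ x ∈ Y, Γ y x *
          ((∫ ω : EuclideanSpace ℝ ι, exp (-(∑ x' ∈ Y, w x' (ω x' + ψ x'))) * (F (ω z + ψ z) * w' x (ω x + ψ x))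
              ∂(multivariateGaussian 0 Γ)) /
              (∫ ω : EuclideanSpace ℝ ι, exp (-(∑ x ∈ Y, w x (ω x + ψ x))) ∂(multivariateGaussian 0 Γ)) -
            (∫ ω : EuclideanSpace ℝ ι, exp (-(∑ x' ∈ Y, w x' (ω x' + ψ x'))) * w' x (ω x + ψ x) ∂(multivariateGaussian 0 Γ)) /
                (∫ ω : EuclideanSpace ℝ ι, exp (-(∑ x ∈ Y, w x (ω x + ψ x))) ∂(multivariateGaussian 0 Γ)) *
              ((∫ ω : EuclideanSpace ℝ ι, exp (-(∑ x ∈ Y, w x (ω x + ψ x))) * F (ω z + ψ z) ∂(multivariateGaussian 0 Γ)) /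
                (∫ ω : EuclideanSpace ℝ ι, exp (-(∑ x ∈ Y, w x (ω x + ψ x))) ∂(multivariateGaussian 0 Γ)))) := by
  have hwm : ∀ x, Measurable (w x) := fun x => (hwC x).continuous.measurable
  obtain ⟨-, hZ⟩ := lineZ_pos' Γ Y hwm hw0 ψ
  rw [tilted_stein Y ψ y z hΓ hwC hw' hw'm hw0 hκ₁ hw'b hFC hF' hF'm hc hFg hF'g, tilted_stein_mean Y ψ y hΓ hwC hw' hw'm hw0 hκ₁ hw'b]
  exact cov_algebra_sum Y (fun x => Γ y x)
    (fun x => ∫ ω : EuclideanSpace ℝ ι, exp (-(∑ x' ∈ Y, w x' (ω x' + ψ x'))) * w' x (ω x + ψ x) ∂(multivariateGaussian 0 Γ))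
    (fun x => ∫ ω : EuclideanSpace ℝ ι, exp (-(∑ x' ∈ Y, w x' (ω x' + ψ x'))) * (F (ω z + ψ z) * w' x (ω x + ψ x))
      ∂(multivariateGaussian 0 Γ)) hZ.ne'

end Main

/-! ## §3. Toy -/

/-- Toy (§1's bookkeeping): a one-term row with `g = I = J = id`. -/
example (Z IG IG' γ : ℝ) (hZ : Z ≠ 0) :
    (γ * IG' - ∑ x ∈ ({1} : Finset ℕ), (x : ℝ) * x) / Z - (-(∑ x ∈ ({1} : Finset ℕ), (x : ℝ) * x)) / Z * (IG / Z) =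
      γ * (IG' / Z) - ∑ x ∈ ({1} : Finset ℕ), (x : ℝ) * (x / Z - x / Z * (IG / Z)) :=
  cov_algebra_sum {1} (fun n : ℕ => (n : ℝ)) (fun n : ℕ => (n : ℝ)) (fun n : ℕ => (n : ℝ)) hZ

end Summit.QuantumFields.BalabanUV.T4Continuum.NE7b.SupTiltedLinearCovariance
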